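import Mathlib
import HarnessLib
import Literature.MathematicalPhysics.QuantumLattice.FermiRG.BGM2003SectorCountingProof
import Summits.HubbardSuperconductivity.HubbardSuperconductivity.Theorems.KLProgrammeH10TwoPointLimitFrameDispersionHyp
import Summits.HubbardSuperconductivity.HubbardSuperconductivity.Theorems.KLProgrammeH10TwoPointLimitPerturbedSectorBoxUniform
import Summits.HubbardSuperconductivity.HubbardSuperconductivity.Theorems.KLProgrammeH10TwoPointLimitPerturbedChartBounds
import Summits.HubbardSuperconductivity.HubbardSuperconductivity.Theorems.KLProgrammeH10TwoPointLimitPerturbedNormalAngleLipschitz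

/-!
# Route `KLProgramme` — K1/K3 (stmt-HubbardSuperconductivity-19938 / 20437), located item «(L−3)-FRAME-UNIFORM-c» CLOSED:
# BGM 2003's SECTOR COUNTING LEMMA 3.1 (the `(L−3)` relative count, momentum conservation in `ℝ²`) with ONE constant
# for the curves of ALL frames of small `C²` size — in particular of ALL admissible frames in the KL regime

Cell gate-hubbard-kl, seat p4 (C5a), g12.  `frameOK_bgm2003_sectorCounting` (`…FrameBGM2003SectorCounting`, g11) gives Benfatto–Giuliani–
Mastropietro 2003 Lemma 3.1 (4.3) on the s-sectors of the curve `{ε₀ + δ_K = μ + e}` of every admissible frame `K`, with the constant `c`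
t3's proof `lemma31_sectorCounting_holds` produces from the frame's `DispersionHyp` datum — so `c = c(K, μ)`.  The wave's gap G-002 /
E1-TOWER-BLOCKED §5 asks for `c` UNIFORM along the family.  This file closes it by composing the EXPLICIT-CONSTANT twin
`BGM2003.lemma31_sectorCounting_of_constants` (p583890: `c = 48(K_fib + 1)` explicit in `(c_u, M, c₂, c₃, c₀, c₂′, η₀)`) with the lineage's
δ-UNIFORM data for the chart `u₂ θ e := perturbedFermiRadius δ (μ + e) θ`:
(u1) `c_u = u_min`, `M` (`chart_radius_ge`, `chart_radius_bounds`); (u2) the Gauss-map Lipschitz constant `c₂ = 2 + U₂/u_min` and the half-turn law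
(`normalAngle_perturbed_lipschitz`, `normalAngle_perturbed_add_pi`); (u3) the sector box `c₃` (`sectorBox_perturbed_uniform`); (u4) the parallelogram
lemma with explicit `c₀, c₂′, η₀ = 1` (`BGM2003.lemma75_parallelogram_of_bounds`, fed by `chart_curvature_ge` / `chart_radius_bounds`).
All these constants depend on the band constants `B`, the sizes `κ₁, κ₂` and the shell `e₀` only:

* `sectorCounting_perturbed_uniform` — for `B : BandBounds a b`, sizes `0 ≤ κ₁, κ₂` with `2κ₁ ≤ Dt_min` and the convexity margin, and a shell
  `e₀ > 0`, ONE `c > 0` such that for EVERY even `δ ∈ C^∞` with `|δ| ≤ κ₀`, `‖Dδ‖ ≤ κ₁`, `‖D²δ‖ ≤ κ₂` and EVERY `μ` with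
  `[μ − κ₀ − 2e₀, μ + κ₀ + 2e₀] ⊂ [a, b]`: `#sectorStrings ≤ c^L 2^{(n′−n)(L−3)}` (`L ≥ 4`), `≤ c` (`L = 2`);
* `frame_bgm2003_sectorCounting_uniform` — for every level window `[μ₁, μ₂] ⊂ (-4, 0)`: `∃ e₀ κ c > 0`, for EVERY frame `K` of `C²` size `A`,
  `4A ≤ κ`, and every `μ ∈ [μ₁, μ₂]`, the same bound with THIS `c`;
* `frameOK_bgm2003_sectorCounting_uniform` — the same ON EVERY ADMISSIBLE FRAME IN THE KL REGIME (`FrameOK R U (nScales β) ν K`), `c` chosen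
  before `R, U, β, μ, ν, K`.

The torus (`2πℤ²`, umklapp-corner) part of the `(L−3)` count is NOT here (splitter `sum_signedReps_eq_zero_of_offUmklapp_frameOK` + the
one-determined-leg rows).  Everything is PROVED by composition; no definitions, no named facts.  References: BGM 2003 §3.1 Lemma 3.1 (4.3),
§7.1 Lemmas 7.1/7.3, §7.3 Lemma 7.5, §7.4 [cite: BenfattoGiulianiMastropietro2003]; BGM 2006 §2.4 Lemma 2.1, App. A3 [cite: BenfattoGiulianiMastropietro2006].
-/

noncomputable section

namespace Summit.HubbardSuperconductivity.HubbardSuperconductivity.Theorems.PerturbedFermiCurve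

set_option linter.dupNamespace false -- summit = problem name (single-conjunct summit), D-0017

open Real Set
open Literature.MathematicalPhysics.QuantumLattice Literature.MathematicalPhysics.QuantumLattice.BandSectorCounting
open Literature.MathematicalPhysics.QuantumLattice.FermiRG Literature.MathematicalPhysics.QuantumLattice.FermiRG.BGM2003
open Summit.HubbardSuperconductivity.HubbardSuperconductivity.Theorems.DispersionFlow
open Summit.HubbardSuperconductivity.HubbardSuperconductivity.Theorems.KLRegimeSplit

/-! ## §1 One constant for the whole family `{δ : |δ| ≤ κ₀, ‖Dδ‖ ≤ κ₁, ‖D²δ‖ ≤ κ₂}` and all admissible levels -/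

/-- `5 ≤ 48(K + 1)` for `K ≥ 0` (the two-leg count against the general constant). [folklore] -/
theorem five_le_fortyEight_mul {K : ℝ} (hK : 0 ≤ K) : (5 : ℝ) ≤ 48 * (K + 1) := by linarith

set_option maxHeartbeats 1600000 in -- the explicit constants are large closed terms (seven `positivity` side goals on them)
/-- **BGM 2003 Lemma 3.1 (4.3) for the perturbed curve, ONE constant for the family.**  Let `B : BandBounds a b`, `0 ≤ κ₁`, `0 ≤ κ₂`,
`2κ₁ ≤ Dt_min`, the convexity margin `h_min ≤ 2h_E − κ₂S_E²` of `dispersionHyp_perturbed`, and `0 < e₀`.  There is `c > 0` such that for every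
even `δ ∈ C^∞` with `|δ| ≤ κ₀`, `‖Dδ‖ ≤ κ₁`, `‖D²δ‖ ≤ κ₂` (globally) and every `μ` with `a + κ₀ + 2e₀ ≤ μ ≤ b − κ₀ − 2e₀`: for all `n ≤ n′`, the
number of scale-`n′` s-sector strings of the chart `u₂ θ e = perturbedFermiRadius δ (μ + e) θ` (shell `e₀`) refining given scale-`n` sectors
(first entry fixed) and compatible with `Σ k⃗ᵢ = 0` in `ℝ²` is `≤ c^L 2^{(n′−n)(L−3)}` for `L ≥ 4` and `≤ c` for `L = 2`
(`c = 48(K_fib + 1)` of `lemma31_sectorCounting_of_constants` on the data (u1)–(u4)). [cite: BenfattoGiulianiMastropietro2003, §3.1 Lemma 3.1 (4.3) and §7.4] -/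
theorem sectorCounting_perturbed_uniform {a b : ℝ} (B : BandBounds a b) {κ₀ κ₁ κ₂ e₀ : ℝ} (he₀ : 0 < e₀)
    (hκ₁0 : 0 ≤ κ₁) (hκ₂0 : 0 ≤ κ₂) (hκ₁D : 2 * κ₁ ≤ B.Dtmin)
    (hconv : B.hmin ≤ 2 * (B.hmin - 4 * (κ₁ * (π * Real.sqrt 2 + 2 * B.smax) / (B.Dtmin - κ₁)) *
        ((B.smax + κ₁ * (π * Real.sqrt 2 + 2 * B.smax) / (B.Dtmin - κ₁)) + B.smax)) -
        κ₂ * (B.smax + κ₁ * (π * Real.sqrt 2 + 2 * B.smax) / (B.Dtmin - κ₁)) ^ 2) :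
    ∃ c : ℝ, 0 < c ∧ ∀ (δ : (Fin 2 → ℝ) → ℝ), ContDiff ℝ ((⊤ : ℕ∞) : WithTop ℕ∞) δ → (∀ k, δ (-k) = δ k) →
      (∀ k : Fin 2 → ℝ, |δ k| ≤ κ₀) → (∀ k : Fin 2 → ℝ, ‖fderiv ℝ δ k‖ ≤ κ₁) → (∀ k : Fin 2 → ℝ, ‖fderiv ℝ (fderiv ℝ δ) k‖ ≤ κ₂) →
      ∀ μ : ℝ, a + κ₀ + 2 * e₀ ≤ μ → μ + κ₀ + 2 * e₀ ≤ b →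
      ∀ (n n' : ℕ), n ≤ n' →
        (∀ (L : ℕ) (i₁ : Fin L) (ω₁ : ℕ) (ωt : Fin L → ℕ), 4 ≤ L → ω₁ < sectorCount n' → (∀ i, ωt i < sectorCount n) →
          (Nat.card (sectorStrings (fun ϑ e => perturbedFermiRadius δ (μ + e) ϑ) e₀ n n' L i₁ ω₁ ωt) : ℝ) ≤
            c ^ L * (2 : ℝ) ^ ((n' - n) * (L - 3))) ∧
        (∀ (i₁ : Fin 2) (ω₁ : ℕ) (ωt : Fin 2 → ℕ), ω₁ < sectorCount n' → (∀ i, ωt i < sectorCount n) →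
          (Nat.card (sectorStrings (fun ϑ e => perturbedFermiRadius δ (μ + e) ϑ) e₀ n n' 2 i₁ ω₁ ωt) : ℝ) ≤ c) := by
  have hDt := B.Dtmin_pos; have hum := B.umin_pos; have hsm := B.smax_pos; have hhm := B.hmin_pos; have hπ := Real.pi_pos
  have hκ₁lt : κ₁ < B.Dtmin := by linarith
  have hden : 0 < B.Dtmin - κ₁ := sub_pos.2 hκ₁lt
  have h00 : |(0 : ℝ)| ≤ e₀ := by rw [abs_zero]; exact he₀.le
  -- (u3): the δ-uniform sector box
  obtain ⟨c₃, hc₃, hbox⟩ := sectorBox_perturbed_uniform B (κ₀ := κ₀) he₀ hκ₁0 hκ₁lt hκ₂0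
  -- the composition, for every `δ, μ` (the constant `48(K_fib + 1)` of the conclusion is read off by unification below)
  have hmain := fun (δ : (Fin 2 → ℝ) → ℝ) (hδs : ContDiff ℝ ((⊤ : ℕ∞) : WithTop ℕ∞) δ) (heven : ∀ k, δ (-k) = δ k)
      (hδ : ∀ k : Fin 2 → ℝ, |δ k| ≤ κ₀) (hκ : ∀ k : Fin 2 → ℝ, ‖fderiv ℝ δ k‖ ≤ κ₁)
      (hκ₂ : ∀ k : Fin 2 → ℝ, ‖fderiv ℝ (fderiv ℝ δ) k‖ ≤ κ₂)
      (μ : ℝ) (hlo : a + κ₀ + 2 * e₀ ≤ μ) (hhi : μ + κ₀ + 2 * e₀ ≤ b) (n n' : ℕ) (hn : n ≤ n') =>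
    have hδ2 : ContDiff ℝ 2 δ := hδs.of_le (WithTop.coe_le_coe.mpr le_top)
    have hδ' : ∀ k : Fin 2 → ℝ, (∀ i, |k i| ≤ π) → |δ k| ≤ κ₀ := fun k _ => hδ k
    have hκ' : ∀ k : Fin 2 → ℝ, (∀ i, |k i| ≤ π) → ‖fderiv ℝ δ k‖ ≤ κ₁ := fun k _ => hκ k
    have hκ₂' : ∀ k : Fin 2 → ℝ, (∀ i, |k i| ≤ π) → ‖fderiv ℝ (fderiv ℝ δ) k‖ ≤ κ₂ := fun k _ => hκ₂ k
    have hlo0 : a ≤ μ - κ₀ := by linarith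
    have hhi0 : μ + κ₀ ≤ b := by linarith
    have hlo1 : a ≤ μ - κ₀ - e₀ := by linarith
    have hhi1 : μ + κ₀ + e₀ ≤ b := by linarith
    -- BGM 2003 §1.2 for the chart; (u1) radius data; (u2) Gauss map; (u3) box; (u4) parallelogram lemma
    have hD := dispersionHyp_perturbed B hδs heven hδ' hκ' hκ₂' hκ₁D hconv he₀ hlo hhi
    have hrad := chart_radius_ge B hδ2 hδ' hlo1 hhi1
    have hM := chart_radius_bounds B hδ2 hδ' hlo1 hhi1 hκ' hκ₁lt hκ₂'
    lemma31_sectorCounting_of_constants hD hum (fun θ : ℝ => ⟨hrad θ 0 h00, (le_abs_self _).trans (hM θ 0 h00).1⟩)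
      (normalAngle_perturbed_lipschitz B hδ2 hδ' hlo0 hhi0 hκ' hκ₁lt hκ₂') (fun θ => normalAngle_perturbed_add_pi heven θ)
      (by positivity) hc₃ (hbox δ hδ2 hδ hκ hκ₂ μ hlo1 hhi1) rfl rfl rfl (by positivity) (by positivity) one_pos
      (lemma75_parallelogram_of_bounds hD hum hrad (by positivity) (chart_curvature_ge B hδ2 hδ' hlo1 hhi1 hκ' hκ₁lt hκ₂' hconv)
        (by positivity) hM (by positivity))
      rfl rfl n n' hn
  exact ⟨_, by positivity, fun δ hδs heven hδ hκ hκ₂ μ hlo hhi n n' hn =>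
    ⟨(hmain δ hδs heven hδ hκ hκ₂ μ hlo hhi n n' hn).1, fun i₁ ω₁ ωt hω₁ hωt =>
      ((hmain δ hδs heven hδ hκ hκ₂ μ hlo hhi n n' hn).2 i₁ ω₁ ωt hω₁ hωt).trans (five_le_fortyEight_mul (by positivity))⟩⟩

/-! ## §2 On the curve of every frame of small `C²` size, with one constant -/

/-- **BGM 2003 Lemma 3.1 (4.3) ON THE CURVES OF ALL FRAMES of small `C²` size, ONE constant**: for every level window `[μ₁, μ₂] ⊂ (-4, 0)`
there are `e₀, κ, c > 0` such that for EVERY frame `K` with `C²` size `A`, `4A ≤ κ`, and EVERY `μ ∈ [μ₁, μ₂]`: for all `n ≤ n′`, the number of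
scale-`n′` s-sector strings of the curve `{ε₀ + δ_K = μ + e}` (shell `e₀`) refining given scale-`n` sectors (first entry fixed) compatible with
`Σ k⃗ᵢ = 0` in `ℝ²` is `≤ c^L 2^{(n′−n)(L−3)}` (`L ≥ 4`) and `≤ c` (`L = 2`). [cite: BenfattoGiulianiMastropietro2003, §3.1 Lemma 3.1 (4.3) and §7.4] -/
theorem frame_bgm2003_sectorCounting_uniform :
    ∀ μ₁ μ₂ : ℝ, -4 < μ₁ → μ₁ ≤ μ₂ → μ₂ < 0 → ∃ e₀ : ℝ, 0 < e₀ ∧ ∃ κ : ℝ, 0 < κ ∧ ∃ c : ℝ, 0 < c ∧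
      ∀ (K : TrigPolyC4v) (A : ℝ), (∀ p : Momentum, ∀ j ≤ 2, ‖iteratedFDeriv ℝ j (frameShift K) p‖ ≤ A) → 4 * A ≤ κ →
      ∀ μ ∈ Set.Icc μ₁ μ₂, ∀ (n n' : ℕ), n ≤ n' →
        (∀ (L : ℕ) (i₁ : Fin L) (ω₁ : ℕ) (ωt : Fin L → ℕ), 4 ≤ L → ω₁ < sectorCount n' → (∀ i, ωt i < sectorCount n) →
          (Nat.card (sectorStrings (fun ϑ e => perturbedFermiRadius (fun k : Fin 2 → ℝ => frameShift K (WithLp.toLp 2 k)) (μ + e) ϑ)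
            e₀ n n' L i₁ ω₁ ωt) : ℝ) ≤ c ^ L * (2 : ℝ) ^ ((n' - n) * (L - 3))) ∧
        (∀ (i₁ : Fin 2) (ω₁ : ℕ) (ωt : Fin 2 → ℕ), ω₁ < sectorCount n' → (∀ i, ωt i < sectorCount n) →
          (Nat.card (sectorStrings (fun ϑ e => perturbedFermiRadius (fun k : Fin 2 → ℝ => frameShift K (WithLp.toLp 2 k)) (μ + e) ϑ)
            e₀ n n' 2 i₁ ω₁ ωt) : ℝ) ≤ c) := by
  intro μ₁ μ₂ hμ₁ h12 hμ₂
  have ha : -4 < (μ₁ - 4) / 2 := by linarith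
  have hab : (μ₁ - 4) / 2 ≤ μ₂ / 2 := by linarith
  have hb : μ₂ / 2 < 0 := by linarith
  obtain ⟨B, -⟩ : ∃ B : BandBounds ((μ₁ - 4) / 2) (μ₂ / 2), B = bandBounds ha hab hb := ⟨_, rfl⟩
  obtain ⟨m₀, hm₀def⟩ : ∃ m₀ : ℝ, m₀ = min (μ₁ - (μ₁ - 4) / 2) (μ₂ / 2 - μ₂) := ⟨_, rfl⟩
  have hm₀ : 0 < m₀ := by rw [hm₀def]; exact lt_min (by linarith) (by linarith)
  have hm1 : m₀ ≤ μ₁ - (μ₁ - 4) / 2 := by rw [hm₀def]; exact min_le_left _ _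
  have hm2 : m₀ ≤ μ₂ / 2 - μ₂ := by rw [hm₀def]; exact min_le_right _ _
  have hDt := B.Dtmin_pos; have hs := B.smax_pos; have hh := B.hmin_pos; have hπ := Real.pi_pos
  -- the uniform majorants of `K_V`, `S_E` (as in `dispersionHyp_frame`)
  obtain ⟨c₁, hc₁⟩ : ∃ c₁ : ℝ, c₁ = π * Real.sqrt 2 + 2 * B.smax := ⟨_, rfl⟩
  have hc₁0 : 0 < c₁ := by rw [hc₁]; positivity
  obtain ⟨cV, hcV⟩ : ∃ cV : ℝ, cV = 2 * c₁ / B.Dtmin := ⟨_, rfl⟩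
  have hcV0 : 0 < cV := by rw [hcV]; positivity
  obtain ⟨SEm, hSEm⟩ : ∃ SEm : ℝ, SEm = B.smax + c₁ := ⟨_, rfl⟩
  have hSEm0 : 0 < SEm := by rw [hSEm]; positivity
  obtain ⟨κ, hκdef⟩ : ∃ κ : ℝ, κ = min B.Dtmin (min m₀ (B.hmin / (4 * cV * (SEm + B.smax) + SEm ^ 2))) := ⟨_, rfl⟩
  have hκ0 : 0 < κ := by rw [hκdef]; exact lt_min hDt (lt_min hm₀ (by positivity))
  have hκD : κ ≤ B.Dtmin := by rw [hκdef]; exact min_le_left _ _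
  have hκm : κ ≤ m₀ := by rw [hκdef]; exact (min_le_right _ _).trans (min_le_left _ _)
  have hκh : κ ≤ B.hmin / (4 * cV * (SEm + B.smax) + SEm ^ 2) := by rw [hκdef]; exact (min_le_right _ _).trans (min_le_right _ _)
  -- the extreme sizes `A₀ = κ/4`: `κ₀ = A₀`, `κ₁ = 2A₀`, `κ₂ = 4A₀`
  obtain ⟨A, hAdef⟩ : ∃ A : ℝ, A = κ / 4 := ⟨_, rfl⟩
  have hA0 : 0 ≤ A := by rw [hAdef]; positivity
  have hAκ : 4 * A ≤ κ := by rw [hAdef]; linarith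
  have h2κ₁ : 2 * (2 * A) ≤ B.Dtmin := by linarith
  -- the convexity margin at the extreme sizes (verbatim the computation of `dispersionHyp_frame`)
  have hden : B.Dtmin / 2 ≤ B.Dtmin - 2 * A := by linarith
  have hden0 : 0 < B.Dtmin - 2 * A := by linarith
  have hKV : 2 * A * (π * Real.sqrt 2 + 2 * B.smax) / (B.Dtmin - 2 * A) ≤ cV * (2 * A) := by
    rw [← hc₁, hcV, div_le_iff₀ hden0]
    have e : 2 * c₁ / B.Dtmin * (2 * A) * (B.Dtmin - 2 * A) = 2 * A * c₁ * (2 * (B.Dtmin - 2 * A) / B.Dtmin) := by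
      field_simp
    rw [e]
    have h1 : 1 ≤ 2 * (B.Dtmin - 2 * A) / B.Dtmin := by rw [le_div_iff₀ hDt]; linarith
    have h0 : 0 ≤ 2 * A * c₁ := by positivity
    nlinarith
  have hKV0 : 0 ≤ 2 * A * (π * Real.sqrt 2 + 2 * B.smax) / (B.Dtmin - 2 * A) := by positivity
  have hSE : B.smax + 2 * A * (π * Real.sqrt 2 + 2 * B.smax) / (B.Dtmin - 2 * A) ≤ SEm := by
    have hKV' : 2 * A * (π * Real.sqrt 2 + 2 * B.smax) / (B.Dtmin - 2 * A) ≤ c₁ := by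
      refine hKV.trans ?_
      rw [hcV]
      have : 2 * c₁ / B.Dtmin * (2 * A) = c₁ * (4 * A / B.Dtmin) := by
        field_simp
        ring
      rw [this]
      have h1 : 4 * A / B.Dtmin ≤ 1 := by rw [div_le_one hDt]; linarith
      nlinarith
    rw [hSEm]; linarith
  have hSE0 : 0 ≤ B.smax + 2 * A * (π * Real.sqrt 2 + 2 * B.smax) / (B.Dtmin - 2 * A) := by positivity
  have hconv : B.hmin ≤ 2 * (B.hmin - 4 * (2 * A * (π * Real.sqrt 2 + 2 * B.smax) / (B.Dtmin - 2 * A)) *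
        ((B.smax + 2 * A * (π * Real.sqrt 2 + 2 * B.smax) / (B.Dtmin - 2 * A)) + B.smax)) -
        4 * A * (B.smax + 2 * A * (π * Real.sqrt 2 + 2 * B.smax) / (B.Dtmin - 2 * A)) ^ 2 := by
    have h1 : 4 * (2 * A * (π * Real.sqrt 2 + 2 * B.smax) / (B.Dtmin - 2 * A)) *
        ((B.smax + 2 * A * (π * Real.sqrt 2 + 2 * B.smax) / (B.Dtmin - 2 * A)) + B.smax) ≤ 4 * (cV * (2 * A)) * (SEm + B.smax) :=
      mul_le_mul (mul_le_mul_of_nonneg_left hKV (by norm_num)) (by linarith) (by positivity) (by positivity)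
    have h2 : 4 * A * (B.smax + 2 * A * (π * Real.sqrt 2 + 2 * B.smax) / (B.Dtmin - 2 * A)) ^ 2 ≤ 4 * A * SEm ^ 2 :=
      mul_le_mul_of_nonneg_left (pow_le_pow_left₀ hSE0 hSE 2) (by positivity)
    have h3 : κ * (4 * cV * (SEm + B.smax) + SEm ^ 2) ≤ B.hmin := by
      rwa [le_div_iff₀ (by positivity)] at hκh
    have h5 : 0 ≤ 4 * cV * (SEm + B.smax) + SEm ^ 2 := by positivity
    nlinarith [mul_le_mul_of_nonneg_right hAκ h5]
  -- the uniform count at the extreme sizes, shell `e₀ = m₀/4`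
  obtain ⟨c, hc, hcount⟩ := sectorCounting_perturbed_uniform B (κ₀ := A) (e₀ := m₀ / 4) (by positivity)
    (by positivity : 0 ≤ 2 * A) (by positivity : 0 ≤ 4 * A) h2κ₁ hconv
  refine ⟨m₀ / 4, by positivity, κ, hκ0, c, hc, ?_⟩
  intro K A' hA' hA'κ μ hμ n n' hn
  have hA'A : A' ≤ A := by rw [hAdef]; linarith
  -- the frame's perturbation obeys the extreme sizes
  have hδ : ∀ k : Fin 2 → ℝ, |frameShift K (WithLp.toLp 2 k)| ≤ A := fun k => (abs_frameShift_toLp_le hA' k).trans hA'A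
  have hκ₁ : ∀ k : Fin 2 → ℝ, ‖fderiv ℝ (fun k : Fin 2 → ℝ => frameShift K (WithLp.toLp 2 k)) k‖ ≤ 2 * A :=
    fun k => (norm_fderiv_frameShift_toLp_le hA' k).trans (by linarith)
  have hκ₂ : ∀ k : Fin 2 → ℝ, ‖fderiv ℝ (fderiv ℝ (fun k : Fin 2 → ℝ => frameShift K (WithLp.toLp 2 k))) k‖ ≤ 4 * A :=
    fun k => (norm_fderiv_fderiv_frameShift_toLp_le hA' k).trans (by linarith)
  have hlo : (μ₁ - 4) / 2 + A + 2 * (m₀ / 4) ≤ μ := by linarith [hμ.1]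
  have hhi : μ + A + 2 * (m₀ / 4) ≤ μ₂ / 2 := by linarith [hμ.2]
  exact hcount _ (contDiff_frameShift_toLp K) (frameShift_toLp_neg K) hδ hκ₁ hκ₂ μ hlo hhi n n' hn

/-! ## §3 On every admissible frame in the KL regime, with one constant -/

/-- **BGM 2003 Lemma 3.1 (4.3) ON EVERY ADMISSIBLE FRAME IN THE KL REGIME, ONE constant** («(L−3)-FRAME-UNIFORM-c»): for the window there
are `e₀, c′ > 0` and, for every renormalisation package `R` (`Gfr ≥ 0`), thresholds `c₃, U₀ > 0` such that for all `0 < c ≤ c₃`, `0 < U ≤ U₀`,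
`klBetaMin ≤ β ≤ e^{c/U²}`, every `μ ∈ [μ₁, μ₂]` and every frame with `FrameOK R U (nScales β) ν K`: `#sectorStrings ≤ c′^L 2^{(n′−n)(L−3)}`
(`L ≥ 4`), `≤ c′` (`L = 2`) — `c′` depends on the window only. [cite: BenfattoGiulianiMastropietro2003, §3.1 Lemma 3.1 (4.3) and §7.4] -/
theorem frameOK_bgm2003_sectorCounting_uniform :
    ∀ μ₁ μ₂ : ℝ, -4 < μ₁ → μ₁ ≤ μ₂ → μ₂ < 0 → ∃ e₀ : ℝ, 0 < e₀ ∧ ∃ c' : ℝ, 0 < c' ∧ ∀ R : RenConsts, (∀ j, 0 ≤ R.Gfr j) →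
      ∃ c₃ : ℝ, 0 < c₃ ∧ ∃ U₀ : ℝ, 0 < U₀ ∧
      ∀ c : ℝ, 0 < c → c ≤ c₃ → ∀ U : ℝ, 0 < U → U ≤ U₀ → ∀ β : ℝ, klBetaMin ≤ β → β ≤ Real.exp (c / U ^ 2) →
      ∀ μ ∈ Set.Icc μ₁ μ₂, ∀ (ν : ℝ) (K : TrigPolyC4v), FrameOK R U (nScales β) ν K →
      ∀ (n n' : ℕ), n ≤ n' →
        (∀ (L : ℕ) (i₁ : Fin L) (ω₁ : ℕ) (ωt : Fin L → ℕ), 4 ≤ L → ω₁ < sectorCount n' → (∀ i, ωt i < sectorCount n) →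
          (Nat.card (sectorStrings (fun ϑ e => perturbedFermiRadius (fun k : Fin 2 → ℝ => frameShift K (WithLp.toLp 2 k)) (μ + e) ϑ)
            e₀ n n' L i₁ ω₁ ωt) : ℝ) ≤ c' ^ L * (2 : ℝ) ^ ((n' - n) * (L - 3))) ∧
        (∀ (i₁ : Fin 2) (ω₁ : ℕ) (ωt : Fin 2 → ℕ), ω₁ < sectorCount n' → (∀ i, ωt i < sectorCount n) →
          (Nat.card (sectorStrings (fun ϑ e => perturbedFermiRadius (fun k : Fin 2 → ℝ => frameShift K (WithLp.toLp 2 k)) (μ + e) ϑ)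
            e₀ n n' 2 i₁ ω₁ ωt) : ℝ) ≤ c') := by
  intro μ₁ μ₂ hμ₁ h12 hμ₂
  obtain ⟨e₀, he₀, κ, hκ, c', hc', h⟩ := frame_bgm2003_sectorCounting_uniform μ₁ μ₂ hμ₁ h12 hμ₂
  refine ⟨e₀, he₀, c', hc', fun R hR => ?_⟩
  obtain ⟨c₃, hc₃, U₀, hU₀, hthr⟩ := frame_thresholds hR hκ
  refine ⟨c₃, hc₃, U₀, hU₀, ?_⟩
  intro c hc hcle U hU hUle β hβmin hβc μ hμ ν K hK
  exact h K _ (fun p j hj => norm_iteratedFDeriv_frameShift_le_of_frameOK_regime hR hc.le hβmin hβc hK p hj)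
    (hthr c U hc.le hcle hU hUle) μ hμ

/-- **The four-leg case, one constant**: `≤ c′⁴·2^{n′−n}` fine refinements on every admissible frame. [cite: BenfattoGiulianiMastropietro2003, §3.1 Lemma 3.1 (4.3)] -/
theorem frameOK_bgm2003_sectorCounting_uniform_four :
    ∀ μ₁ μ₂ : ℝ, -4 < μ₁ → μ₁ ≤ μ₂ → μ₂ < 0 → ∃ e₀ : ℝ, 0 < e₀ ∧ ∃ c' : ℝ, 0 < c' ∧ ∀ R : RenConsts, (∀ j, 0 ≤ R.Gfr j) →
      ∃ c₃ : ℝ, 0 < c₃ ∧ ∃ U₀ : ℝ, 0 < U₀ ∧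
      ∀ c : ℝ, 0 < c → c ≤ c₃ → ∀ U : ℝ, 0 < U → U ≤ U₀ → ∀ β : ℝ, klBetaMin ≤ β → β ≤ Real.exp (c / U ^ 2) →
      ∀ μ ∈ Set.Icc μ₁ μ₂, ∀ (ν : ℝ) (K : TrigPolyC4v), FrameOK R U (nScales β) ν K →
      ∀ (n n' : ℕ), n ≤ n' → ∀ (i₁ : Fin 4) (ω₁ : ℕ) (ωt : Fin 4 → ℕ), ω₁ < sectorCount n' → (∀ i, ωt i < sectorCount n) →
          (Nat.card (sectorStrings (fun ϑ e => perturbedFermiRadius (fun k : Fin 2 → ℝ => frameShift K (WithLp.toLp 2 k)) (μ + e) ϑ)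
            e₀ n n' 4 i₁ ω₁ ωt) : ℝ) ≤ c' ^ 4 * (2 : ℝ) ^ (n' - n) := by
  intro μ₁ μ₂ hμ₁ h12 hμ₂
  obtain ⟨e₀, he₀, c', hc', h⟩ := frameOK_bgm2003_sectorCounting_uniform μ₁ μ₂ hμ₁ h12 hμ₂
  refine ⟨e₀, he₀, c', hc', fun R hR => ?_⟩
  obtain ⟨c₃, hc₃, U₀, hU₀, hreg⟩ := h R hR
  refine ⟨c₃, hc₃, U₀, hU₀, ?_⟩
  intro c hc hcle U hU hUle β hβmin hβc μ hμ ν K hK n n' hn i₁ ω₁ ωt hω₁ hωt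
  have h4 := (hreg c hc hcle U hU hUle β hβmin hβc μ hμ ν K hK n n' hn).1 4 i₁ ω₁ ωt le_rfl hω₁ hωt
  simpa using h4

/-! ## §4 With a PRESCRIBED shell `e₀` (e.g. the KL family's `klE0`), one constant -/

/-- **BGM 2003 Lemma 3.1 (4.3) ON THE CURVES OF ALL FRAMES of small `C²` size, prescribed shell, ONE constant**: for every shell `e₀ > 0` and level
window `[μ₁, μ₂]` with `-4 < μ₁ − 4e₀`, `μ₂ + 4e₀ < 0` there are `κ, c > 0` such that for EVERY frame `K` with `C²` size `A`, `4A ≤ κ`, and EVERY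
`μ ∈ [μ₁, μ₂]`: for all `n ≤ n′`, the number of scale-`n′` s-sector strings of the curve `{ε₀ + δ_K = μ + e}` WITH SHELL `e₀` refining given scale-`n`
sectors (first entry fixed) compatible with `Σ k⃗ᵢ = 0` in `ℝ²` is `≤ c^L 2^{(n′−n)(L−3)}` (`L ≥ 4`) and `≤ c` (`L = 2`) — the shell is the caller's (the
KL family's supports at scale `n` live in the shell `klE0·4^{−n}`, so `e₀ = klE0` hosts them). [cite: BenfattoGiulianiMastropietro2003, §3.1 Lemma 3.1 (4.3) and §7.4] -/
theorem frame_bgm2003_sectorCounting_uniform_shell :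
    ∀ μ₁ μ₂ e₀ : ℝ, 0 < e₀ → -4 < μ₁ - 4 * e₀ → μ₁ ≤ μ₂ → μ₂ + 4 * e₀ < 0 → ∃ κ : ℝ, 0 < κ ∧ ∃ c : ℝ, 0 < c ∧
      ∀ (K : TrigPolyC4v) (A : ℝ), (∀ p : Momentum, ∀ j ≤ 2, ‖iteratedFDeriv ℝ j (frameShift K) p‖ ≤ A) → 4 * A ≤ κ →
      ∀ μ ∈ Set.Icc μ₁ μ₂, ∀ (n n' : ℕ), n ≤ n' →
        (∀ (L : ℕ) (i₁ : Fin L) (ω₁ : ℕ) (ωt : Fin L → ℕ), 4 ≤ L → ω₁ < sectorCount n' → (∀ i, ωt i < sectorCount n) →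
          (Nat.card (sectorStrings (fun ϑ e => perturbedFermiRadius (fun k : Fin 2 → ℝ => frameShift K (WithLp.toLp 2 k)) (μ + e) ϑ)
            e₀ n n' L i₁ ω₁ ωt) : ℝ) ≤ c ^ L * (2 : ℝ) ^ ((n' - n) * (L - 3))) ∧
        (∀ (i₁ : Fin 2) (ω₁ : ℕ) (ωt : Fin 2 → ℕ), ω₁ < sectorCount n' → (∀ i, ωt i < sectorCount n) →
          (Nat.card (sectorStrings (fun ϑ e => perturbedFermiRadius (fun k : Fin 2 → ℝ => frameShift K (WithLp.toLp 2 k)) (μ + e) ϑ)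
            e₀ n n' 2 i₁ ω₁ ωt) : ℝ) ≤ c) := by
  intro μ₁ μ₂ e₀ he₀ hμ₁ h12 hμ₂
  have hab : μ₁ - 4 * e₀ ≤ μ₂ + 4 * e₀ := by linarith
  obtain ⟨B, -⟩ : ∃ B : BandBounds (μ₁ - 4 * e₀) (μ₂ + 4 * e₀), B = bandBounds hμ₁ hab hμ₂ := ⟨_, rfl⟩
  have hDt := B.Dtmin_pos; have hs := B.smax_pos; have hh := B.hmin_pos; have hπ := Real.pi_pos
  -- the uniform majorants of `K_V`, `S_E` (as in `dispersionHyp_frame`)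
  obtain ⟨c₁, hc₁⟩ : ∃ c₁ : ℝ, c₁ = π * Real.sqrt 2 + 2 * B.smax := ⟨_, rfl⟩
  have hc₁0 : 0 < c₁ := by rw [hc₁]; positivity
  obtain ⟨cV, hcV⟩ : ∃ cV : ℝ, cV = 2 * c₁ / B.Dtmin := ⟨_, rfl⟩
  have hcV0 : 0 < cV := by rw [hcV]; positivity
  obtain ⟨SEm, hSEm⟩ : ∃ SEm : ℝ, SEm = B.smax + c₁ := ⟨_, rfl⟩
  have hSEm0 : 0 < SEm := by rw [hSEm]; positivity
  obtain ⟨κ, hκdef⟩ : ∃ κ : ℝ, κ = min B.Dtmin (min (8 * e₀) (B.hmin / (4 * cV * (SEm + B.smax) + SEm ^ 2))) := ⟨_, rfl⟩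
  have hκ0 : 0 < κ := by rw [hκdef]; exact lt_min hDt (lt_min (by positivity) (by positivity))
  have hκD : κ ≤ B.Dtmin := by rw [hκdef]; exact min_le_left _ _
  have hκm : κ ≤ 8 * e₀ := by rw [hκdef]; exact (min_le_right _ _).trans (min_le_left _ _)
  have hκh : κ ≤ B.hmin / (4 * cV * (SEm + B.smax) + SEm ^ 2) := by rw [hκdef]; exact (min_le_right _ _).trans (min_le_right _ _)
  -- the extreme sizes `A₀ = κ/4`: `κ₀ = A₀`, `κ₁ = 2A₀`, `κ₂ = 4A₀`
  obtain ⟨A, hAdef⟩ : ∃ A : ℝ, A = κ / 4 := ⟨_, rfl⟩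
  have hA0 : 0 ≤ A := by rw [hAdef]; positivity
  have hAκ : 4 * A ≤ κ := by rw [hAdef]; linarith
  have h2κ₁ : 2 * (2 * A) ≤ B.Dtmin := by linarith
  -- the convexity margin at the extreme sizes (verbatim the computation of `dispersionHyp_frame`)
  have hden0 : 0 < B.Dtmin - 2 * A := by linarith
  have hKV : 2 * A * (π * Real.sqrt 2 + 2 * B.smax) / (B.Dtmin - 2 * A) ≤ cV * (2 * A) := by
    rw [← hc₁, hcV, div_le_iff₀ hden0]
    have e : 2 * c₁ / B.Dtmin * (2 * A) * (B.Dtmin - 2 * A) = 2 * A * c₁ * (2 * (B.Dtmin - 2 * A) / B.Dtmin) := by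
      field_simp
    rw [e]
    have h1 : 1 ≤ 2 * (B.Dtmin - 2 * A) / B.Dtmin := by rw [le_div_iff₀ hDt]; linarith
    have h0 : 0 ≤ 2 * A * c₁ := by positivity
    nlinarith
  have hKV0 : 0 ≤ 2 * A * (π * Real.sqrt 2 + 2 * B.smax) / (B.Dtmin - 2 * A) := by positivity
  have hSE : B.smax + 2 * A * (π * Real.sqrt 2 + 2 * B.smax) / (B.Dtmin - 2 * A) ≤ SEm := by
    have hKV' : 2 * A * (π * Real.sqrt 2 + 2 * B.smax) / (B.Dtmin - 2 * A) ≤ c₁ := by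
      refine hKV.trans ?_
      rw [hcV]
      have : 2 * c₁ / B.Dtmin * (2 * A) = c₁ * (4 * A / B.Dtmin) := by
        field_simp
        ring
      rw [this]
      have h1 : 4 * A / B.Dtmin ≤ 1 := by rw [div_le_one hDt]; linarith
      nlinarith
    rw [hSEm]; linarith
  have hSE0 : 0 ≤ B.smax + 2 * A * (π * Real.sqrt 2 + 2 * B.smax) / (B.Dtmin - 2 * A) := by positivity
  have hconv : B.hmin ≤ 2 * (B.hmin - 4 * (2 * A * (π * Real.sqrt 2 + 2 * B.smax) / (B.Dtmin - 2 * A)) *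
        ((B.smax + 2 * A * (π * Real.sqrt 2 + 2 * B.smax) / (B.Dtmin - 2 * A)) + B.smax)) -
        4 * A * (B.smax + 2 * A * (π * Real.sqrt 2 + 2 * B.smax) / (B.Dtmin - 2 * A)) ^ 2 := by
    have h1 : 4 * (2 * A * (π * Real.sqrt 2 + 2 * B.smax) / (B.Dtmin - 2 * A)) *
        ((B.smax + 2 * A * (π * Real.sqrt 2 + 2 * B.smax) / (B.Dtmin - 2 * A)) + B.smax) ≤ 4 * (cV * (2 * A)) * (SEm + B.smax) :=
      mul_le_mul (mul_le_mul_of_nonneg_left hKV (by norm_num)) (by linarith) (by positivity) (by positivity)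
    have h2 : 4 * A * (B.smax + 2 * A * (π * Real.sqrt 2 + 2 * B.smax) / (B.Dtmin - 2 * A)) ^ 2 ≤ 4 * A * SEm ^ 2 :=
      mul_le_mul_of_nonneg_left (pow_le_pow_left₀ hSE0 hSE 2) (by positivity)
    have h3 : κ * (4 * cV * (SEm + B.smax) + SEm ^ 2) ≤ B.hmin := by
      rwa [le_div_iff₀ (by positivity)] at hκh
    have h5 : 0 ≤ 4 * cV * (SEm + B.smax) + SEm ^ 2 := by positivity
    nlinarith [mul_le_mul_of_nonneg_right hAκ h5]
  -- the uniform count at the extreme sizes, prescribed shell `e₀`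
  obtain ⟨c, hc, hcount⟩ := sectorCounting_perturbed_uniform B (κ₀ := A) (e₀ := e₀) he₀
    (by positivity : 0 ≤ 2 * A) (by positivity : 0 ≤ 4 * A) h2κ₁ hconv
  refine ⟨κ, hκ0, c, hc, ?_⟩
  intro K A' hA' hA'κ μ hμ n n' hn
  have hA'A : A' ≤ A := by rw [hAdef]; linarith
  have hδ : ∀ k : Fin 2 → ℝ, |frameShift K (WithLp.toLp 2 k)| ≤ A := fun k => (abs_frameShift_toLp_le hA' k).trans hA'A
  have hκ₁ : ∀ k : Fin 2 → ℝ, ‖fderiv ℝ (fun k : Fin 2 → ℝ => frameShift K (WithLp.toLp 2 k)) k‖ ≤ 2 * A :=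
    fun k => (norm_fderiv_frameShift_toLp_le hA' k).trans (by linarith)
  have hκ₂ : ∀ k : Fin 2 → ℝ, ‖fderiv ℝ (fderiv ℝ (fun k : Fin 2 → ℝ => frameShift K (WithLp.toLp 2 k))) k‖ ≤ 4 * A :=
    fun k => (norm_fderiv_fderiv_frameShift_toLp_le hA' k).trans (by linarith)
  have hA2 : A ≤ 2 * e₀ := by rw [hAdef]; linarith
  have hlo : μ₁ - 4 * e₀ + A + 2 * e₀ ≤ μ := by linarith [hμ.1]
  have hhi : μ + A + 2 * e₀ ≤ μ₂ + 4 * e₀ := by linarith [hμ.2]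
  exact hcount _ (contDiff_frameShift_toLp K) (frameShift_toLp_neg K) hδ hκ₁ hκ₂ μ hlo hhi n n' hn

/-- **BGM 2003 Lemma 3.1 (4.3) ON EVERY ADMISSIBLE FRAME IN THE KL REGIME, prescribed shell, ONE constant**: for every shell `e₀ > 0` and window
`[μ₁, μ₂]` with `-4 < μ₁ − 4e₀`, `μ₂ + 4e₀ < 0` there is `c′ > 0` and, for every `R` (`Gfr ≥ 0`), thresholds `c₃, U₀ > 0` such that for all
`0 < c ≤ c₃`, `0 < U ≤ U₀`, `klBetaMin ≤ β ≤ e^{c/U²}`, `μ ∈ [μ₁, μ₂]` and every frame with `FrameOK R U (nScales β) ν K`: the sector strings of the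
frame's curve WITH SHELL `e₀` obey `≤ c′^L 2^{(n′−n)(L−3)}` (`L ≥ 4`), `≤ c′` (`L = 2`). [cite: BenfattoGiulianiMastropietro2003, §3.1 Lemma 3.1 (4.3) and §7.4] -/
theorem frameOK_bgm2003_sectorCounting_uniform_shell :
    ∀ μ₁ μ₂ e₀ : ℝ, 0 < e₀ → -4 < μ₁ - 4 * e₀ → μ₁ ≤ μ₂ → μ₂ + 4 * e₀ < 0 → ∃ c' : ℝ, 0 < c' ∧ ∀ R : RenConsts, (∀ j, 0 ≤ R.Gfr j) →
      ∃ c₃ : ℝ, 0 < c₃ ∧ ∃ U₀ : ℝ, 0 < U₀ ∧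
      ∀ c : ℝ, 0 < c → c ≤ c₃ → ∀ U : ℝ, 0 < U → U ≤ U₀ → ∀ β : ℝ, klBetaMin ≤ β → β ≤ Real.exp (c / U ^ 2) →
      ∀ μ ∈ Set.Icc μ₁ μ₂, ∀ (ν : ℝ) (K : TrigPolyC4v), FrameOK R U (nScales β) ν K →
      ∀ (n n' : ℕ), n ≤ n' →
        (∀ (L : ℕ) (i₁ : Fin L) (ω₁ : ℕ) (ωt : Fin L → ℕ), 4 ≤ L → ω₁ < sectorCount n' → (∀ i, ωt i < sectorCount n) →
          (Nat.card (sectorStrings (fun ϑ e => perturbedFermiRadius (fun k : Fin 2 → ℝ => frameShift K (WithLp.toLp 2 k)) (μ + e) ϑ)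
            e₀ n n' L i₁ ω₁ ωt) : ℝ) ≤ c' ^ L * (2 : ℝ) ^ ((n' - n) * (L - 3))) ∧
        (∀ (i₁ : Fin 2) (ω₁ : ℕ) (ωt : Fin 2 → ℕ), ω₁ < sectorCount n' → (∀ i, ωt i < sectorCount n) →
          (Nat.card (sectorStrings (fun ϑ e => perturbedFermiRadius (fun k : Fin 2 → ℝ => frameShift K (WithLp.toLp 2 k)) (μ + e) ϑ)
            e₀ n n' 2 i₁ ω₁ ωt) : ℝ) ≤ c') := by
  intro μ₁ μ₂ e₀ he₀ hμ₁ h12 hμ₂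
  obtain ⟨κ, hκ, c', hc', h⟩ := frame_bgm2003_sectorCounting_uniform_shell μ₁ μ₂ e₀ he₀ hμ₁ h12 hμ₂
  refine ⟨c', hc', fun R hR => ?_⟩
  obtain ⟨c₃, hc₃, U₀, hU₀, hthr⟩ := frame_thresholds hR hκ
  refine ⟨c₃, hc₃, U₀, hU₀, ?_⟩
  intro c hc hcle U hU hUle β hβmin hβc μ hμ ν K hK
  exact h K _ (fun p j hj => norm_iteratedFDeriv_frameShift_le_of_frameOK_regime hR hc.le hβmin hβc hK p hj)
    (hthr c U hc.le hcle hU hUle) μ hμ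

end Summit.HubbardSuperconductivity.HubbardSuperconductivity.Theorems.PerturbedFermiCurve

end
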